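import Literature.MathematicalPhysics.QuantumFieldTheory.Balaban1983to89.T4InputCauchyRate
import Literature.MathematicalPhysics.QuantumFieldTheory.Balaban1983to89.T4CauchySum

/-!
# OutputRateRemainingScale — the typed NE5 shape against its PRINTED TEMPLATE: remaining-scale profiles of the η-rate
# constant, and how the typed spine absorbs them (cell `pub-balaban`, T⁴-continuum fan-out, `HOME/BINDER-OWNERS.md` row NE5
# (node U3), owner lineage t4-ne5-p1, gen 24; BC5-type census item «witness of weakness of the typed hypothesis shape»; tree
# target `Summits/QuantumFields/BalabanUV/T4Continuum/Support/` — the cell's own bookkeeping, LEAN PLACEMENT RULE 2026-08-19)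

HONEST FRAMING (T4-DAG PAGE 1).  The cell's T⁴ target is rung (B)+1: existence AND uniqueness of the `ε → 0` limit of
gauge-invariant unit-scale observables of pure YM₄ on a FIXED finite torus, CONDITIONAL on `FlowStep.BetaPertH` and on the nine
spine estimates (0/9 proved); NOT infinite volume, NOT the mass gap, NOT the Clay problem.  NE5 (`T4OutputRate.NE5`) is the
cell's own NEW ESTIMATE, NOT PRINTED in [Balaban1987RG1]–[Balaban1989LargeFieldII] and NOT proved.  This module proves real
bookkeeping only; NOTHING of T. Bałaban's construction is asserted; the one published source quoted, C. King, CMP **102** (1986)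
(U(1)-Higgs in d = 2, 3 — OUTSIDE the audited series), is quoted for the FORM of its statements, as the declared printed
template of the typed shape, never as a fact about YM₄.

THE QUESTION (BC5 face of row NE5).  `T4OutputRate.NE5 EA EB W κ θ C₅` asks `|E^A − E^B|(X) ≤ C₅ θ^{scale X} e^{−κ d(X)}` with
ONE constant `C₅` for every domain of every scale of the carrier; its docstring declares as printed model King's propagator
rate (3.73) p. 665 and King's p. 665 sentence *"If we replace such a propagator in E_φ^{(k+n)}(H̃), the error is the same graph
with a difference or propagators on one line. Using the method presented, this error is bounded, and Proposition 3.8 gives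
the desired factor L^{−γk}."* [King1986, p. 665].  What does that method PRINT for the effective-action terms themselves?

THE PRINTED FORM (located, journal pages 660–665 = PDF pp. 12–17 of [King1986]; renders
`HOME/t4/b2b-balaban-t4-ne5-p1/g24/king-renders/1986-cmp102-king-u1-higgs-I-p012…p015-x2.png` and the template seat's
`…-p016/p017-x2.png`; `ε = ε_K` is run A's spacing, `k` the comparison step, so `L^kε = L^{−(K−k)}` and `K − k` is the number
of REMAINING scales):
* Theorem 3.5 (ii) p. 660, per graph `H` with `s` external scalar legs, at fixed external points: *"when dist({y_i},{z_q}) ≤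
  p(L^kε), |E^{(k+n)}(H, A^{(k+n)}; {y_i},{z_q}) − E^{(k)}(H, A^{(k)}; {y_i},{z_q})| ≤ C(L^kε)^{ϱ−1/2}(p(L^kε))^{n₁}[L^{−γk} +
  (L^kε)^{d+σ+1/2}] · exp[−δ dist({y_i},{z_q})]"* (3.39), with (i) the one-run bound *"≤ C(L^kε)^ϱ(p(L^kε))^{n₁} exp[−δ dist]"*
  (3.38) and *"ϱ ≥ s/4"* [King1986, Thm 3.5 (3.38)–(3.39) p. 660];
* where the factors come from, p. 665: *"So we have established Proposition 3.6. The factor (L^kε)^ϱ comes from the vertices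
  (3.18)–(3.26). … Therefore ϱ ≥ s/4. The bound (3.72) gives (L^kε)^{−1/2}."*, (3.72) being *"|U(B(Γ^{(k+n)}_{x₀,x′})) −
  U(B(Γ^{(k)}_{x₀,x}))| ≤ Ce(L^kε)^{2−d/2}L^{−k} p(L^kε)/(μ₀L^kε)"* — the zero mode `B` of the massive NON-COMPACT vector field,
  bounded through the small-field condition *"|A_{k,μ}(y)| ≤ p(L^{k−1}ε)(μ₀L^{k−1}ε)^{−1}"* (3.2) p. 655 — and `n₁ = n₂ + 2r`
  powers of the field threshold *"p(ε) = b₀(1 + log ε^{−1})^p"* (3.1) p. 655 from (3.45) p. 661 and *"|□′| ≤ C(p(L^kε))^d"*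
  p. 664 [King1986, (3.72) p. 665; (3.1)–(3.2) p. 655; (3.45) p. 661];
* the step total, p. 660 (3.42): *"≤ C(L^kε)^{−1/2}(p(L^kε))^{n₁}[L^{−γk} + (L^kε)^{d+σ+1/2}](L^kε)^{−d}|T| ≤ C[L^{−γk}(L^kε)^{−β}
  + (L^kε)^{σ′}]|T|"* — the factor `(L^kε)^{−d}|T|` being the number of unit-lattice sites [King1986, (3.42) p. 660].
So the printed per-graph η-rate constant is NOT uniform in the remaining scales: reading `n = K − k`, it carries the
REMAINING-SCALE PROFILE `Λ_King(n) = L^{(1/2 − ϱ) n} · b₀^{n₁}(1 + n log L)^{p n₁}` — a GEOMETRIC factor `L^{n/2}` for vacuum graphs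
(`s = 0`, `ϱ = 0`) from the non-compact zero mode (3.72), times a POLYNOMIAL factor from the polylogarithmic thresholds (3.1).
King never telescopes to `k = K`: his σ-channel (superrenormalisability) lets him compare at `k = 2βK/(2β+γ)` ((3.12) p. 657),
where both factors are affordable.  The d = 4 spine has no σ-channel (`t4/KING-TEMPLATE.md` §3.3 (a)) and runs to `k = K`.

CONSEQUENCE FOR THE TYPED SHAPES (this module's content, kernel-checked bookkeeping; [analysis] where so marked).
(1) The typed `NE5` (profile ≡ 1) is the STRONGEST member of the family `NE5R … K Λr C₅` below (§1) and is STRONGER IN FORM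
    than its printed template (profile `Λ_King`).  The cell's downstream nodes already tolerate weaker members: node U6's
    `T4CauchySum.InjectedRate C c θ inj` carries `(K+1)^c` (polynomial profiles, §4), node U4′'s `T4Crossover` a geometric
    growth `Λ^{K−j}` crossed with the printed sizes.
(2) A GEOMETRIC profile `lam^{K−j}` is, at fixed `K`, LITERALLY the typed `NE5` at the faster rate `θ/lam` with the constant
    `C₅·lam^K` (§2, `boundedAtScale_of_ne5R_geom` / `ne5R_geom_of_ne5_div`): no new shape is needed to state it.
(3) Node U3's recursion ABSORBS a geometric profile in its operator source by the substitution `ω ↦ lam·ω` in the history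
    damping: `RecursiveRate … (θ/lam) ω (A·lam^K) b` (= source `A θ^k lam^{K−k}`, `source_geom`) and the lineage's smallness
    at the damped rate, `(1 + b)·lam·ω < θ`, give `NE5R … θ K (lam^·) (A(θ − lam ω)/(θ − (1+b) lam ω))` — a `K`-UNIFORM constant
    in front of the profile (§3, `ne5R_geom_of_recursiveRate`, from the lineage's `T4InputCauchyRate.ne5_of_recursiveRate` BY
    NAME).  The loss spends damping: the admissible `lam` are `lam < θ/((1+b)ω)`.
(4) Node U6 ABSORBS a geometric profile by the substitution `ρ ↦ lam·ρ` in the transport: `delta E ρ inj = delta E (lam ρ)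
    (inj/lam^{K−j})` exactly (`delta_eq_delta_div_geom`), so `Summable (delta E ρ inj)` as soon as `lam·ρ < 1`
    (`summable_delta_of_geomProfile`, from `T4CauchySum.summable_delta` BY NAME); a polynomial profile `((K−j)+1)^p` is inside
    `InjectedRate` with exponent `c + p` (`injectedRate_of_polyProfile`).
(5) [analysis, recorded not proved] For Bałaban's YM₄ no source of a GEOMETRIC remaining-scale profile is located: the
    analogue of King's thresholds are the powers of `p₀(g_k) = (log g_k^{−2})^{p₀}`, polynomial in `K − k` under the flow (inside
    (4)); the zero-mode denominator `μ₀L^kε` of (3.2)/(3.72) belongs to the non-compact abelian field and has no counterpart in the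
    compact averaging set-up.  So the typed face (profile 1, or polynomial) remains the expected one — but it is a CHOICE stronger
    than the template, now displayed with its exact slack: geometric losses up to `min(θ/((1+b)ω), 1/ρ)` would still close the
    spine through (3)–(4).

WHAT IS PROVED: real-number bookkeeping (powers, one finite-sum identity over `Finset.antidiagonal`, the imported closures at
substituted parameters).  0 sorry; axioms ⊆ {propext, Classical.choice, Quot.sound}; imports the LANDED modules
`T4InputCauchyRate` (p184298; `disc`, `BoundedAtScale`, `RecursiveRate`, `ne5_of_recursiveRate`) and `T4CauchySum`
(`InjectedRate`, `delta`, `summable_delta`) BY NAME and modifies nothing.  NOT COVERED: any instance for Bałaban's objects; King's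
theorems themselves (quoted for their FORM only); NE2, NE3, BetaPertH, (B), (B^μ).  Record: `t4/T4-EST-NE5-P1.md` §50; GAPS
`G-ne5p1-1‴ UPDATE 18`.

VERSION.  v1 = p200215 (2026-08-19).  v1.0.1 = this file: DOCFIX ONLY per XREAD `HOME/b2b-balaban-gan24-formalise-leaf-20/XREAD-
OutputRateRemainingScale-v1.md` (journal l.2583; ok CONSISTENT 10∕10, DOCFIX 2 LOW): (3.1) is displayed on p. 655 (not p. 654); the
profile's threshold factor reads `b₀^{n₁}(1 + n log L)^{p n₁}` (v1 wrote `(b₀(1 + n log L))^{p n₁}`).  Every declaration, statement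
and proof byte-identical to v1.
-/

noncomputable section

open Finset

namespace Summit.QuantumFields.BalabanUV.T4Continuum.OutputRateRemainingScale

open Literature.MathematicalPhysics.QuantumFieldTheory.Balaban1983to89
open Literature.MathematicalPhysics.QuantumFieldTheory.Balaban1983to89.T4OutputRate
open Literature.MathematicalPhysics.QuantumFieldTheory.Balaban1983to89.T4InputCauchyRate

/-! ## §1 The NE5 family with a remaining-scale profile -/

section Shape

variable {C : Carriers}

/-- HYPOTHESIS SHAPE (NOT PRINTED for YM₄; the FORM of King's (3.39) p. 660): NE5 for a run of depth `K` with a REMAINING-SCALE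
PROFILE `Λr` — on the window `W`, for every background and every domain created at a step `j ≤ K`,
`|E^A − E^B|(X) ≤ C₅ · Λr(K − j) · θ^j · e^{−κ d(X)}`.  The typed `T4OutputRate.NE5` is the member `Λr ≡ 1`; King's printed
per-graph constant has `Λr(n) = (L^kε)^{ϱ−1/2}(p(L^kε))^{n₁}` read at `L^kε = L^{−n}`.
[cite: King1986, Thm 3.5 (3.39) p. 660] -/
def NE5R (EA : Functional C C.BgA) (EB : Functional C C.BgB) (W : Set (ℕ → ℝ)) (κ θ : ℝ) (K : ℕ) (Λr : ℕ → ℝ)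
    (C₅ : ℝ) : Prop :=
  ∀ g ∈ W, ∀ (U : C.BgB) (X : C.Dom), C.scale X ≤ K →
    disc EA EB g U X ≤ C₅ * Λr (K - C.scale X) * θ ^ C.scale X * Real.exp (-(κ * C.d X))

/-- The typed NE5 is the STRONGEST member: it gives `NE5R` for every depth `K` and every profile `Λr ≥ 1` (with `C₅ ≥ 0`,
`θ ≥ 0`). [folklore] -/
theorem ne5R_of_ne5 {EA : Functional C C.BgA} {EB : Functional C C.BgB} {W : Set (ℕ → ℝ)} {κ θ C₅ : ℝ}
    (h : NE5 EA EB W κ θ C₅) (hC₅ : 0 ≤ C₅) (hθ : 0 ≤ θ) {Λr : ℕ → ℝ} (hΛ : ∀ n, 1 ≤ Λr n) (K : ℕ) :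
    NE5R EA EB W κ θ K Λr C₅ := by
  intro g hg U X _
  have h1 := h g hg U X
  have hfac : 0 ≤ C₅ * θ ^ C.scale X * Real.exp (-(κ * C.d X)) :=
    mul_nonneg (mul_nonneg hC₅ (pow_nonneg hθ _)) (Real.exp_pos _).le
  calc disc EA EB g U X ≤ C₅ * θ ^ C.scale X * Real.exp (-(κ * C.d X)) := h1
    _ = C₅ * 1 * θ ^ C.scale X * Real.exp (-(κ * C.d X)) := by ring
    _ ≤ C₅ * Λr (K - C.scale X) * θ ^ C.scale X * Real.exp (-(κ * C.d X)) := by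
        have := mul_le_mul_of_nonneg_left (hΛ (K - C.scale X)) hfac
        calc C₅ * 1 * θ ^ C.scale X * Real.exp (-(κ * C.d X))
            = C₅ * θ ^ C.scale X * Real.exp (-(κ * C.d X)) * 1 := by ring
          _ ≤ C₅ * θ ^ C.scale X * Real.exp (-(κ * C.d X)) * Λr (K - C.scale X) := this
          _ = C₅ * Λr (K - C.scale X) * θ ^ C.scale X * Real.exp (-(κ * C.d X)) := by ring

/-- Conversely the unit-profile member at every depth IS the typed NE5 (every domain has a finite scale). [folklore] -/
theorem ne5_of_ne5R_one {EA : Functional C C.BgA} {EB : Functional C C.BgB} {W : Set (ℕ → ℝ)} {κ θ C₅ : ℝ}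
    (h : ∀ K, NE5R EA EB W κ θ K (fun _ => 1) C₅) : NE5 EA EB W κ θ C₅ := by
  intro g hg U X
  have := h (C.scale X) g hg U X le_rfl
  simpa [disc] using this

/-- `NE5R` read slice by slice: for `j ≤ K` it is the lineage's `BoundedAtScale` with constant `C₅ Λr(K−j) θ^j`. [folklore] -/
theorem boundedAtScale_of_ne5R {EA : Functional C C.BgA} {EB : Functional C C.BgB} {W : Set (ℕ → ℝ)} {κ θ C₅ : ℝ}
    {K : ℕ} {Λr : ℕ → ℝ} (h : NE5R EA EB W κ θ K Λr C₅) {j : ℕ} (hj : j ≤ K) :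
    BoundedAtScale EA EB W κ j (C₅ * Λr (K - j) * θ ^ j) := by
  intro g hg U X hX
  have := h g hg U X (hX ▸ hj)
  rwa [hX] at this

/-- … and the slices `j ≤ K` reassemble `NE5R`. [folklore] -/
theorem ne5R_of_boundedAtScale {EA : Functional C C.BgA} {EB : Functional C C.BgB} {W : Set (ℕ → ℝ)} {κ θ C₅ : ℝ}
    {K : ℕ} {Λr : ℕ → ℝ} (h : ∀ j ≤ K, BoundedAtScale EA EB W κ j (C₅ * Λr (K - j) * θ ^ j)) :
    NE5R EA EB W κ θ K Λr C₅ :=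
  fun g hg U X hX => h (C.scale X) hX g hg U X rfl

end Shape

/-! ## §2 A geometric profile is the typed NE5 at a faster rate with a depth-dependent constant -/

section Geometric

variable {C : Carriers}

/-- The algebra of the substitution: for `lam ≠ 0` and `j ≤ K`, `(C₅ lam^K)·(θ/lam)^j = C₅ · lam^{K−j} · θ^j`. [folklore] -/
theorem geom_profile_eq {lam θ C₅ : ℝ} (hlam : lam ≠ 0) {j K : ℕ} (hj : j ≤ K) :
    C₅ * lam ^ K * (θ / lam) ^ j = C₅ * lam ^ (K - j) * θ ^ j := by
  obtain ⟨n, rfl⟩ := Nat.exists_eq_add_of_le hj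
  rw [Nat.add_sub_cancel_left, pow_add, div_pow]
  field_simp

/-- **GEOMETRIC PROFILE ⇐ FASTER RATE.**  The typed NE5 at rate `θ/lam` with constant `C₅·lam^K` IS `NE5R` at rate `θ`,
depth `K`, profile `lam^{K−j}`, constant `C₅` (`lam ≠ 0`). [folklore] -/
theorem ne5R_geom_of_ne5_div {EA : Functional C C.BgA} {EB : Functional C C.BgB} {W : Set (ℕ → ℝ)} {κ θ C₅ lam : ℝ}
    (hlam : lam ≠ 0) {K : ℕ} (h : NE5 EA EB W κ (θ / lam) (C₅ * lam ^ K)) :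
    NE5R EA EB W κ θ K (fun n => lam ^ n) C₅ := by
  intro g hg U X hX
  have h1 := h g hg U X
  rwa [geom_profile_eq hlam hX] at h1

/-- **FASTER RATE ⇐ GEOMETRIC PROFILE**, slice by slice on the scales `j ≤ K` the profile speaks about: `NE5R` at rate `θ` with
profile `lam^{K−j}` gives the lineage's `BoundedAtScale` at scale `j` with the constant `(C₅ lam^K)(θ/lam)^j` of the typed NE5 at
rate `θ/lam`. [folklore] -/
theorem boundedAtScale_of_ne5R_geom {EA : Functional C C.BgA} {EB : Functional C C.BgB} {W : Set (ℕ → ℝ)}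
    {κ θ C₅ lam : ℝ} (hlam : lam ≠ 0) {K : ℕ} (h : NE5R EA EB W κ θ K (fun n => lam ^ n) C₅) {j : ℕ} (hj : j ≤ K) :
    BoundedAtScale EA EB W κ j (C₅ * lam ^ K * (θ / lam) ^ j) := by
  rw [geom_profile_eq hlam hj]
  exact boundedAtScale_of_ne5R h hj

end Geometric

/-! ## §3 Node U3: the recursion absorbs a geometric remaining-scale loss by `ω ↦ lam·ω` -/

section Recursion

variable {C : Carriers}

/-- READING OF THE SOURCE.  A recursive block budget at rate `θ/lam` with operator constant `A·lam^K` has, at the scales `k ≤ K`,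
the source term `A · lam^{K−k} · θ^k`: the operator channel with a GEOMETRIC remaining-scale loss `lam` per remaining scale
(King's `(L^kε)^{−1/2}` is `lam = L^{1/2}`). [folklore] -/
theorem source_geom {A lam θ : ℝ} (hlam : lam ≠ 0) {k K : ℕ} (hk : k ≤ K) :
    A * lam ^ K * (θ / lam) ^ k = A * lam ^ (K - k) * θ ^ k :=
  geom_profile_eq hlam hk

/-- **THE LOSS SPENDS DAMPING.**  If the recursive block budget of the lineage holds at rate `θ/lam` with operator constant
`A·lam^K` (i.e. operator source `A θ^k lam^{K−k}`, `source_geom`), history damping `ω` and history constant `b`, with `lam ≥ 1`,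
`0 ≤ A, b, ω` and the SMALLNESS AT THE DAMPED RATE `(1 + b)·(lam·ω) < θ`, then `NE5R` holds at rate `θ`, depth `K`, profile
`lam^{K−j}`, with the `K`-UNIFORM constant `A(θ − lam ω)/(θ − (1+b) lam ω)` — the lineage's constant of
`T4InputCauchyRate.ne5_of_recursiveRate` with `ω` replaced by `lam·ω`.  (At `lam = 1` this is that theorem.) [folklore] -/
theorem ne5R_geom_of_recursiveRate {EA : Functional C C.BgA} {EB : Functional C C.BgB} {W : Set (ℕ → ℝ)}
    {κ θ ω A b lam : ℝ} {K : ℕ} (hlam : 1 ≤ lam) (hA : 0 ≤ A) (hb : 0 ≤ b) (hω : 0 ≤ ω)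
    (hsmall : (1 + b) * (lam * ω) < θ) (h : RecursiveRate EA EB W κ (θ / lam) ω (A * lam ^ K) b) :
    NE5R EA EB W κ θ K (fun n => lam ^ n) (A * (θ - lam * ω) / (θ - (1 + b) * (lam * ω))) := by
  have hlam0 : 0 < lam := one_pos.trans_le hlam
  have hlamne : lam ≠ 0 := hlam0.ne'
  have hsmall' : (1 + b) * ω < θ / lam := by
    rw [lt_div_iff₀ hlam0]
    nlinarith
  have hAK : 0 ≤ A * lam ^ K := mul_nonneg hA (pow_nonneg hlam0.le K)
  have h5 := ne5_of_recursiveRate hAK hb hω hsmall' h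
  -- the constant of the lineage at rate θ/lam is `(A lam^K)(θ/lam − ω)/(θ/lam − (1+b)ω) = (A(θ − lam ω)/(θ − (1+b) lam ω))·lam^K`
  have hden : θ - (1 + b) * (lam * ω) ≠ 0 := by nlinarith
  have hden' : θ / lam - (1 + b) * ω ≠ 0 := (sub_pos.mpr hsmall').ne'
  have hconst : A * lam ^ K * (θ / lam - ω) / (θ / lam - (1 + b) * ω)
      = A * (θ - lam * ω) / (θ - (1 + b) * (lam * ω)) * lam ^ K := by
    have e1 : θ / lam - ω = (θ - lam * ω) / lam := by field_simp
    have e2 : θ / lam - (1 + b) * ω = (θ - (1 + b) * (lam * ω)) / lam := by field_simp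
    rw [e1, e2]
    field_simp
  rw [hconst] at h5
  exact ne5R_geom_of_ne5_div hlamne h5

/-- Decided arithmetic witness that the damped smallness leaves room for a loss `lam > 1`: with `θ = 1/2`, `ω = 1/8`, `b = 1`
the lineage's smallness `(1+b)ω < θ` holds with slack, and the loss `lam = 3/2` (> King's `L^{1/2}` at `L = 2`, `√2 < 3/2`)
is still admissible: `(1+1)·(3/2·1/8) = 3/8 < 1/2`. [folklore] -/
example : (1 + (1 : ℝ)) * ((3 / 2 : ℝ) * (1 / 8)) < 1 / 2 := by norm_num

/-- … while `lam = 2` is not (`(1+1)·(2·1/8) = 1/2`): the admissible losses are exactly `lam < θ/((1+b)ω) = 2`. [folklore] -/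
example : ¬ (1 + (1 : ℝ)) * ((2 : ℝ) * (1 / 8)) < 1 / 2 := by norm_num

end Recursion

/-! ## §4 Node U6: injected rates with a remaining-scale profile -/

section Transport

open Literature.MathematicalPhysics.QuantumFieldTheory.Balaban1983to89.T4CauchySum

/-- HYPOTHESIS SHAPE: node U6's injected rate with a REMAINING-SCALE PROFILE `Λr` on top of the typed polynomial factor —
`0 ≤ inj K j ≤ Cc (K+1)^c θ^j Λr(K − j)` for `j ≤ K`.  `Λr ≡ 1` is `T4CauchySum.InjectedRate`; King's (3.42) p. 660 has the
form `Λr(n) = L^{βn}` before his choice of `k`. [cite: King1986, (3.42) p. 660] -/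
def InjectedRateR (Cc : ℝ) (c : ℕ) (θ : ℝ) (Λr : ℕ → ℝ) (inj : ℕ → ℕ → ℝ) : Prop :=
  ∀ K j : ℕ, j ≤ K → 0 ≤ inj K j ∧ inj K j ≤ Cc * ((K : ℝ) + 1) ^ c * θ ^ j * Λr (K - j)

/-- **POLYNOMIAL PROFILES ARE INSIDE THE TYPED SHAPE**: a profile `((K−j)+1)^p` is absorbed into the polynomial factor with
exponent `c + p` (since `(K−j)+1 ≤ K+1`). [folklore] -/
theorem injectedRate_of_polyProfile {Cc θ : ℝ} {c p : ℕ} {inj : ℕ → ℕ → ℝ} (hCc : 0 ≤ Cc) (hθ : 0 ≤ θ)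
    (h : InjectedRateR Cc c θ (fun n => ((n : ℝ) + 1) ^ p) inj) : InjectedRate Cc (c + p) θ inj := by
  intro K j hj
  obtain ⟨h0, h1⟩ := h K j hj
  refine ⟨h0, h1.trans ?_⟩
  have hKj : ((K - j : ℕ) : ℝ) + 1 ≤ (K : ℝ) + 1 := by
    have : ((K - j : ℕ) : ℝ) ≤ (K : ℝ) := by exact_mod_cast Nat.sub_le K j
    linarith
  have hprof : (((K - j : ℕ) : ℝ) + 1) ^ p ≤ ((K : ℝ) + 1) ^ p :=
    pow_le_pow_left₀ (by positivity) hKj p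
  have hfac : 0 ≤ Cc * ((K : ℝ) + 1) ^ c * θ ^ j := mul_nonneg (mul_nonneg hCc (by positivity)) (pow_nonneg hθ j)
  calc Cc * ((K : ℝ) + 1) ^ c * θ ^ j * (((K - j : ℕ) : ℝ) + 1) ^ p
      ≤ Cc * ((K : ℝ) + 1) ^ c * θ ^ j * ((K : ℝ) + 1) ^ p := mul_le_mul_of_nonneg_left hprof hfac
    _ = Cc * ((K : ℝ) + 1) ^ (c + p) * θ ^ j := by ring

/-- **THE TRANSPORT IDENTITY**: a geometric profile moves from the injected rate into the contraction —
`delta E ρ inj K = delta E (lam·ρ) (inj / lam^{K−j}) K` exactly (`lam ≠ 0`; on the antidiagonal `j + n = K` the remaining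
scales are `K − j = n`). [folklore] -/
theorem delta_eq_delta_div_geom {E ρ lam : ℝ} (hlam : lam ≠ 0) (inj : ℕ → ℕ → ℝ) (K : ℕ) :
    delta E ρ inj K = delta E (lam * ρ) (fun K j => inj K j / lam ^ (K - j)) K := by
  unfold delta
  congr 1
  refine Finset.sum_congr rfl fun p hp => ?_
  have hK : K - p.1 = p.2 := by have := mem_antidiagonal.mp hp; omega
  have hpow : lam ^ p.2 ≠ 0 := pow_ne_zero _ hlam
  show inj K p.1 * ρ ^ p.2 = inj K p.1 / lam ^ (K - p.1) * (lam * ρ) ^ p.2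
  rw [hK, mul_pow, div_mul_eq_mul_div, eq_div_iff hpow]
  ring

/-- A geometric profile `lam^{K−j}` divided out leaves a typed injected rate. [folklore] -/
theorem injectedRate_div_of_geomProfile {Cc θ lam : ℝ} {c : ℕ} {inj : ℕ → ℕ → ℝ} (hlam : 0 < lam)
    (h : InjectedRateR Cc c θ (fun n => lam ^ n) inj) :
    InjectedRate Cc c θ (fun K j => inj K j / lam ^ (K - j)) := by
  intro K j hj
  obtain ⟨h0, h1⟩ := h K j hj
  have hpos : 0 < lam ^ (K - j) := pow_pos hlam _
  exact ⟨div_nonneg h0 hpos.le, (div_le_iff₀ hpos).mpr h1⟩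

/-- **NODE U6 ABSORBS A GEOMETRIC PROFILE BY `ρ ↦ lam·ρ`.**  Under an injected rate with polynomial factor `(K+1)^c`, rate
`θ ∈ [0,1[` and geometric remaining-scale profile `lam^{K−j}` (`lam > 0`), contraction `ρ ≥ 0` per remaining scale and `E ≥ 0`,
the transported totals `delta E ρ inj` are summable as soon as `lam·ρ < 1` — `T4CauchySum.summable_delta` at the contraction
`lam·ρ`.  (King's `(L^kε)^{−β}` would need `L^β ρ < 1`: the loss exponent below the contraction exponent.) [folklore] -/
theorem summable_delta_of_geomProfile {Cc θ E ρ lam : ℝ} {c : ℕ} {inj : ℕ → ℕ → ℝ} (hlam : 0 < lam)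
    (h : InjectedRateR Cc c θ (fun n => lam ^ n) inj) (hE : 0 ≤ E) (hθ : 0 ≤ θ) (hθ1 : θ < 1) (hρ : 0 ≤ ρ)
    (hlamρ : lam * ρ < 1) : Summable (delta E ρ inj) := by
  have heq : delta E ρ inj = delta E (lam * ρ) (fun K j => inj K j / lam ^ (K - j)) :=
    funext fun K => delta_eq_delta_div_geom hlam.ne' inj K
  rw [heq]
  exact summable_delta (injectedRate_div_of_geomProfile hlam h) hE hθ hθ1 (mul_nonneg hlam.le hρ) hlamρ

/-- The unit profile is the typed shape itself (both directions, definitional up to `mul_one`). [folklore] -/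
theorem injectedRateR_one_iff {Cc θ : ℝ} {c : ℕ} {inj : ℕ → ℕ → ℝ} :
    InjectedRateR Cc c θ (fun _ => 1) inj ↔ InjectedRate Cc c θ inj := by
  simp only [InjectedRateR, InjectedRate, mul_one]

end Transport

/-! ## §5 Non-vacuity: decided toy witnesses of both shapes (and of the absorption, with a loss `lam = 2 > 1`) -/

section Toy

open Literature.MathematicalPhysics.QuantumFieldTheory.Balaban1983to89.T4CauchySum

/-- The lineage's toy pair (`toy_ne5`: outputs `(1/2)^k` versus `0`, NE5 at rate `1/2` with constant `3`) satisfies `NE5R`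
at every depth with King's geometric-type profile `2^{K−j}` (any profile `≥ 1` would do): the shape is inhabited by a
carrier on which it is a TRUE statement. [folklore] -/
theorem toy_ne5R (K : ℕ) : NE5R toyEA toyEB (Set.univ : Set (ℕ → ℝ)) 0 (1 / 2) K (fun n => (2 : ℝ) ^ n) 3 := by
  have h := toy_ne5
  norm_num at h
  exact ne5R_of_ne5 h (by norm_num) (by norm_num) (fun n => one_le_pow₀ (by norm_num)) K

/-- A toy injected rate with a GEOMETRIC remaining-scale loss `2^{K−j}` on top of the rate `(1/2)^j`:
`inj K j = (1/2)^j · 2^{K−j}` — NOT an instance of the typed `InjectedRate` with a `K`-uniform polynomial factor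
(at `j = 0` it is `2^K`), but an instance of `InjectedRateR` with profile `2^n`. [folklore] -/
theorem toy_injectedRateR :
    InjectedRateR 1 0 (1 / 2) (fun n => (2 : ℝ) ^ n) (fun K j => (1 / 2 : ℝ) ^ j * 2 ^ (K - j)) := by
  intro K j _
  refine ⟨by positivity, ?_⟩
  simp

/-- The toy loss is NOT absorbed by a polynomial factor: for every `Cc`, `c` there is a depth `K` with
`inj K 0 = 2^K > Cc (K+1)^c`, so `T4CauchySum.InjectedRate Cc c (1/2)` fails for it — the typed shape is genuinely
stronger than the profiled one. [folklore] -/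
theorem toy_not_injectedRate (Cc : ℝ) (c : ℕ) :
    ¬ InjectedRate Cc c (1 / 2) (fun K j => (1 / 2 : ℝ) ^ j * 2 ^ (K - j)) := by
  intro h
  -- `(K+1)^c / 2^K → 0`, so `Cc (K+1)^c < 2^K` eventually
  have hlim : Filter.Tendsto (fun K : ℕ => Cc * (((K : ℝ) + 1) ^ c * (1 / 2 : ℝ) ^ K)) Filter.atTop (nhds (Cc * 0)) := by
    refine Filter.Tendsto.const_mul Cc ?_
    have h2 : Filter.Tendsto (fun K : ℕ => ((K : ℝ) + 1) ^ c * (1 / 2 : ℝ) ^ (K + 1)) Filter.atTop (nhds 0) := by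
      have := (tendsto_pow_const_mul_const_pow_of_abs_lt_one c
        (show |(1 / 2 : ℝ)| < 1 by rw [abs_of_pos (by norm_num)]; norm_num)).comp (Filter.tendsto_add_atTop_nat 1)
      refine this.congr fun K => ?_
      simp [Function.comp]
    have h3 : (fun K : ℕ => ((K : ℝ) + 1) ^ c * (1 / 2 : ℝ) ^ K)
        = fun K : ℕ => 2 * (((K : ℝ) + 1) ^ c * (1 / 2 : ℝ) ^ (K + 1)) := by
      funext K
      rw [pow_succ]
      ring
    rw [h3]
    simpa using h2.const_mul 2
  rw [mul_zero] at hlim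
  obtain ⟨K, hK⟩ := (Filter.eventually_atTop.mp (hlim.eventually (gt_mem_nhds (show (0 : ℝ) < 1 by norm_num))))
  have hK1 := hK K le_rfl
  have hinj := (h K 0 (Nat.zero_le K)).2
  simp only [pow_zero, one_mul, Nat.sub_zero, mul_one] at hinj
  -- hinj : 2^K ≤ Cc (K+1)^c ; hK1 : Cc ((K+1)^c (1/2)^K) < 1
  have hpos : (0 : ℝ) < (1 / 2 : ℝ) ^ K := by positivity
  have h4 : (2 : ℝ) ^ K * (1 / 2 : ℝ) ^ K = 1 := by rw [← mul_pow]; norm_num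
  have h5 : (2 : ℝ) ^ K * (1 / 2 : ℝ) ^ K ≤ Cc * ((K : ℝ) + 1) ^ c * (1 / 2 : ℝ) ^ K :=
    mul_le_mul_of_nonneg_right hinj hpos.le
  rw [h4] at h5
  linarith [h5, hK1, mul_assoc Cc (((K : ℝ) + 1) ^ c) ((1 / 2 : ℝ) ^ K)]

/-- … yet node U6 absorbs it: with contraction `ρ = 1/4` per remaining scale, `lam·ρ = 1/2 < 1` and the transported totals
are summable (`summable_delta_of_geomProfile`). [folklore] -/
theorem toy_summable_delta (E : ℝ) (hE : 0 ≤ E) :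
    Summable (delta E (1 / 4) (fun K j => (1 / 2 : ℝ) ^ j * 2 ^ (K - j))) :=
  summable_delta_of_geomProfile (lam := 2) (by norm_num) toy_injectedRateR hE (by norm_num) (by norm_num) (by norm_num)
    (by norm_num)

end Toy

end Summit.QuantumFields.BalabanUV.T4Continuum.OutputRateRemainingScale

end
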